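import Summits.Ventures.PercRepro.C041TriDomTwoExitDomination
import Summits.Ventures.PercRepro.C041TriDomExcessZeroDouble

/-!
# ROW C-041 — THEOREM (REDUNDANT EDGE): AN EDGE WHOSE ENDS ARE JOINED BY DOUBLE EDGES IS INVISIBLE
(p6, gen 46; P6-TWOEXIT-LEAN.md §53 ADDENDUM 17)

Write `a ≡ b` for «`a` and `b` are joined by double edges» (`DConn`: connected in both colours in every colouring).
**THEOREM (REDUNDANT EDGE)** (`cycDominationS_of_redundant`, `sibDominationS_of_redundant`): a free edge `f` joining
`a` and `b` with `a ≡ b` (a loop, or a parallel of a contracted path) changes no connectivity in any colouring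
(`RdS_stAbs_eq_of_dconn`, `MgS_stAbs_eq_of_dconn`), so CONJECTURE (STOCHASTIC DOMINATION) and the sibling domination on
`st` and on `st` with `f` deleted (`stAbs st f`) coincide.  The graph theory is ONE lemma (`rtg_or_edge_iff_of_rtg`):
an edge whose ends are already connected changes no connectivity (`reach_iff_of_implied_edge`); deleting an edge that
is not of a colour changes nothing in that colour (`RAdjS_stAbs_eq_of_not_red`).  No mark condition.  The parallel
pairs are `C041TriDomParallelEdge`.
-/

namespace PercRepro

namespace ZoneZ

namespace MultiExit

open ZoneData Finset

variable {V₁ E₁ U₁ U₂ : Type} (Z₁ : ZoneData V₁ E₁ U₁ U₂)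

/-! ## The abstract lemma: an implied edge changes nothing -/

/-- Adding an edge `a–b` to a symmetric relation in which `a` already reaches `b` changes no connectivity. -/
theorem rtg_or_edge_iff_of_rtg {R : V₁ → V₁ → Prop} (hR : ∀ x y, R x y → R y x) {a b : V₁}
    (hab : Relation.ReflTransGen R a b) (x y : V₁) :
    Relation.ReflTransGen (fun c d => R c d ∨ (c = b ∧ d = a) ∨ (c = a ∧ d = b)) x y ↔
      Relation.ReflTransGen R x y := by
  constructor
  · intro h
    induction h with
    | refl => exact Relation.ReflTransGen.refl
    | @tail c d _ hcd ih =>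
      rcases hcd with hcd | ⟨hcb, hda⟩ | ⟨hca, hdb⟩
      · exact ih.tail hcd
      · rw [hda]
        rw [hcb] at ih
        exact ih.trans (rtg_symm hR hab)
      · rw [hdb]
        rw [hca] at ih
        exact ih.trans hab
  · intro h
    induction h with
    | refl => exact Relation.ReflTransGen.refl
    | tail _ hcd ih => exact ih.tail (Or.inl hcd)

/-- The reach through a colour predicate with one more edge whose ends are already connected. -/
theorem reach_iff_of_implied_edge {col col' : E₁ → Prop} {f : E₁} {a b : V₁} (hj : Z₁.Joins f a b)
    (hcol' : ∀ e, col' e ↔ col e ∨ e = f) (hab : b ∈ ZoneData.reach (AdjCol Z₁ col) {a}) (x y : V₁) :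
    y ∈ ZoneData.reach (AdjCol Z₁ col') {x} ↔ y ∈ ZoneData.reach (AdjCol Z₁ col) {x} := by
  have hadj : AdjCol Z₁ col' = fun c d => AdjCol Z₁ col c d ∨ (c = b ∧ d = a) ∨ (c = a ∧ d = b) := by
    funext c d
    exact propext ((AdjCol_iff_of_iff Z₁ hcol' c d).trans (AdjCol_or_edge_iff Z₁ hj c d))
  rw [hadj, mem_reach_singleton, mem_reach_singleton]
  rw [mem_reach_singleton] at hab
  exact rtg_or_edge_iff_of_rtg (AdjCol_symm Z₁ col) hab x y

/-- A red free edge `a'–b'` together with `a ≡ a'`, `b ≡ b'` red-connects `a` and `b`. -/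
theorem RdS_of_parallel_red {st' : E₁ → EStat} {f₁' : E₁} {a b a' b' : V₁} (hj' : Z₁.Joins f₁' a' b') (haa : DConn Z₁ st' a a')
    (hbb : DConn Z₁ st' b b') (ω : E₁ → Bool) (hf' : redE st' ω f₁') : RdS Z₁ st' ω a b :=
  reach_trans' (reach_trans' (RdS_of_dconn Z₁ haa ω)
    ((mem_reach_singleton _ _ _).mpr (Relation.ReflTransGen.single ⟨f₁', hj', hf'⟩)))
    (RdS_of_dconn Z₁ (DConn_symm Z₁ hbb) ω)

/-- A blue free edge `a'–b'` together with `a ≡ a'`, `b ≡ b'` blue-connects `a` and `b`. -/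
theorem MgS_of_parallel_blue {st' : E₁ → EStat} {f₁' : E₁} {a b a' b' : V₁} (hj' : Z₁.Joins f₁' a' b') (haa : DConn Z₁ st' a a')
    (hbb : DConn Z₁ st' b b') (ω : E₁ → Bool) (hf' : blueE st' ω f₁') : MgS Z₁ st' ω a b :=
  reach_trans' (reach_trans' (MgS_of_dconn Z₁ haa ω)
    ((mem_reach_singleton _ _ _).mpr (Relation.ReflTransGen.single ⟨f₁', hj', hf'⟩)))
    (MgS_of_dconn Z₁ (DConn_symm Z₁ hbb) ω)

/-! ## Deleting one edge -/

variable [DecidableEq E₁]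

/-- The status with the edge `f` deleted. -/
def stAbs (st : E₁ → EStat) (f : E₁) : E₁ → EStat := fun e => if e = f then EStat.absent else st e

variable {st : E₁ → EStat} {f : E₁}

/-- Red under `stAbs`: red under `st` and not `f`. -/
theorem redE_stAbs (ω : E₁ → Bool) (e : E₁) : redE (stAbs st f) ω e ↔ redE st ω e ∧ e ≠ f := by
  unfold stAbs redE
  by_cases h : e = f <;> simp [h]

/-- Blue under `stAbs`: blue under `st` and not `f`. -/
theorem blueE_stAbs (ω : E₁ → Bool) (e : E₁) : blueE (stAbs st f) ω e ↔ blueE st ω e ∧ e ≠ f := by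
  unfold stAbs blueE
  by_cases h : e = f <;> simp [h]

/-- Red under `st` is red under `stAbs` or the (red) edge `f`. -/
theorem redE_iff_stAbs_or (ω : E₁ → Bool) (hf : redE st ω f) (e : E₁) :
    redE st ω e ↔ redE (stAbs st f) ω e ∨ e = f := by
  rw [redE_stAbs]
  constructor
  · intro h
    by_cases he : e = f
    · exact Or.inr he
    · exact Or.inl ⟨h, he⟩
  · rintro (⟨h, _⟩ | h)
    · exact h
    · rw [h]
      exact hf

/-- Blue under `st` is blue under `stAbs` or the (blue) edge `f`. -/
theorem blueE_iff_stAbs_or (ω : E₁ → Bool) (hf : blueE st ω f) (e : E₁) :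
    blueE st ω e ↔ blueE (stAbs st f) ω e ∨ e = f := by
  rw [blueE_stAbs]
  constructor
  · intro h
    by_cases he : e = f
    · exact Or.inr he
    · exact Or.inl ⟨h, he⟩
  · rintro (⟨h, _⟩ | h)
    · exact h
    · rw [h]
      exact hf

/-- If `f` is not red, the red adjacencies of `st` and `stAbs` coincide. -/
theorem RAdjS_stAbs_eq_of_not_red (ω : E₁ → Bool) (hf : ¬ redE st ω f) :
    RAdjS Z₁ (stAbs st f) ω = RAdjS Z₁ st ω := by
  apply RAdjS_congr
  intro e
  rw [redE_stAbs]
  constructor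
  · exact fun h => h.1
  · intro h
    refine ⟨h, fun he => hf ?_⟩
    rw [← he]
    exact h

/-- If `f` is not blue, the blue adjacencies of `st` and `stAbs` coincide. -/
theorem BAdjS_stAbs_eq_of_not_blue (ω : E₁ → Bool) (hf : ¬ blueE st ω f) :
    BAdjS Z₁ (stAbs st f) ω = BAdjS Z₁ st ω := by
  apply BAdjS_congr
  intro e
  rw [blueE_stAbs]
  constructor
  · exact fun h => h.1
  · intro h
    refine ⟨h, fun he => hf ?_⟩
    rw [← he]
    exact h

/-- Deleting an edge whose ends stay red-connected changes no red connectivity. -/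
theorem RdS_stAbs_iff_of_rd {a b : V₁} (hj : Z₁.Joins f a b) (ω : E₁ → Bool)
    (hab : RdS Z₁ (stAbs st f) ω a b) (x y : V₁) : RdS Z₁ st ω x y ↔ RdS Z₁ (stAbs st f) ω x y := by
  by_cases hf : redE st ω f
  · unfold RdS
    rw [RAdjS_eq_AdjCol, RAdjS_eq_AdjCol]
    exact reach_iff_of_implied_edge Z₁ hj (redE_iff_stAbs_or ω hf) hab x y
  · unfold RdS
    rw [RAdjS_stAbs_eq_of_not_red Z₁ ω hf]

/-- Deleting an edge whose ends stay blue-connected changes no blue connectivity. -/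
theorem MgS_stAbs_iff_of_mg {a b : V₁} (hj : Z₁.Joins f a b) (ω : E₁ → Bool)
    (hab : MgS Z₁ (stAbs st f) ω a b) (x y : V₁) : MgS Z₁ st ω x y ↔ MgS Z₁ (stAbs st f) ω x y := by
  by_cases hf : blueE st ω f
  · unfold MgS
    rw [BAdjS_eq_AdjCol, BAdjS_eq_AdjCol]
    exact reach_iff_of_implied_edge Z₁ hj (blueE_iff_stAbs_or ω hf) hab x y
  · unfold MgS
    rw [BAdjS_stAbs_eq_of_not_blue Z₁ ω hf]

/-- Deleting a free edge keeps the double edges. -/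
theorem dblE_stAbs_iff (hf : st f = EStat.free) (e : E₁) : dblE (stAbs st f) e ↔ dblE st e := by
  unfold dblE stAbs
  by_cases h : e = f
  · rw [if_pos h, h, hf]
    decide
  · rw [if_neg h]

/-- Deleting a free edge keeps the double connectivity. -/
theorem DConn_stAbs (hf : st f = EStat.free) : DConn Z₁ (stAbs st f) = DConn Z₁ st :=
  DConn_congr Z₁ (dblE_stAbs_iff hf)

/-! ## THEOREM (REDUNDANT EDGE) -/

/-- A free edge whose ends are joined by double edges changes no red connectivity. -/
theorem RdS_stAbs_eq_of_dconn {a b : V₁} (hf : st f = EStat.free) (hj : Z₁.Joins f a b) (hab : DConn Z₁ st a b)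
    (ω : E₁ → Bool) : RdS Z₁ st ω = RdS Z₁ (stAbs st f) ω := by
  funext x y
  apply propext
  refine RdS_stAbs_iff_of_rd Z₁ hj ω ?_ x y
  rw [← DConn_stAbs Z₁ hf] at hab
  exact RdS_of_dconn Z₁ hab ω

/-- A free edge whose ends are joined by double edges changes no blue connectivity. -/
theorem MgS_stAbs_eq_of_dconn {a b : V₁} (hf : st f = EStat.free) (hj : Z₁.Joins f a b) (hab : DConn Z₁ st a b)
    (ω : E₁ → Bool) : MgS Z₁ st ω = MgS Z₁ (stAbs st f) ω := by
  funext x y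
  apply propext
  refine MgS_stAbs_iff_of_mg Z₁ hj ω ?_ x y
  rw [← DConn_stAbs Z₁ hf] at hab
  exact MgS_of_dconn Z₁ hab ω

section Redundant

variable [Fintype E₁]

open Classical in
/-- **THEOREM (REDUNDANT EDGE)**: CONJECTURE (STOCHASTIC DOMINATION) is unchanged by the deletion of a free edge whose
ends are joined by double edges. -/
theorem cycDominationS_of_redundant {a b : V₁} (hf : st f = EStat.free) (hj : Z₁.Joins f a b)
    (hab : DConn Z₁ st a b) (x y z : V₁) (h : CycDominationS Z₁ x y z (stAbs st f)) :
    CycDominationS Z₁ x y z st := by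
  intro V hV
  have hc : ∀ ω, (CycCrossedS Z₁ x y z st ω ↔ CycCrossedS Z₁ x y z (stAbs st f) ω) ∧
      (TopBotS Z₁ x y z st ω ↔ TopBotS Z₁ x y z (stAbs st f) ω) := by
    intro ω
    rw [cycCrossedS_iff, cycCrossedS_iff, topBotS_iff, topBotS_iff, RdS_stAbs_eq_of_dconn Z₁ hf hj hab ω,
      MgS_stAbs_eq_of_dconn Z₁ hf hj hab ω]
    exact ⟨Iff.rfl, Iff.rfl⟩
  exact (card_filter_congr' fun ω _ => and_congr_right fun _ => (hc ω).1).trans_le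
    ((h V hV).trans_eq (card_filter_congr' fun ω _ => and_congr_right fun _ => (hc ω).2.symm))

open Classical in
/-- **THEOREM (REDUNDANT EDGE)** for the sibling domination. -/
theorem sibDominationS_of_redundant {a b : V₁} (hf : st f = EStat.free) (hj : Z₁.Joins f a b)
    (hab : DConn Z₁ st a b) (x y t : V₁) (h : SibDominationS Z₁ x y t (stAbs st f)) :
    SibDominationS Z₁ x y t st := by
  intro V hV
  have hc : ∀ ω, ((SibC₁ Z₁ x y t st ω ∨ SibC₃ Z₁ x y t st ω) ↔
        (SibC₁ Z₁ x y t (stAbs st f) ω ∨ SibC₃ Z₁ x y t (stAbs st f) ω)) ∧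
      (SibTop Z₁ x y t st ω ↔ SibTop Z₁ x y t (stAbs st f) ω) := by
    intro ω
    unfold SibC₁ SibC₃ SibTop
    rw [RdS_stAbs_eq_of_dconn Z₁ hf hj hab ω, MgS_stAbs_eq_of_dconn Z₁ hf hj hab ω]
    exact ⟨Iff.rfl, Iff.rfl⟩
  exact (card_filter_congr' fun ω _ => and_congr_right fun _ => (hc ω).1).trans_le
    ((h V hV).trans_eq (card_filter_congr' fun ω _ => and_congr_right fun _ => (hc ω).2.symm))

end Redundant

end MultiExit

end ZoneZ

end PercRepro
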